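import Summits.Parity.GeneralizedHardyLittlewood.Theorems.PrimeLevelFamEdgeMomentsBeyondDiagonalDiagDecorM6Collapse
import Summits.Parity.GeneralizedHardyLittlewood.Theorems.PrimeLevelFamEdgeMomentsBeyondDiagonalDiagDecorShiftedBlockDecorSel
import HarnessLib

/-!
# Route `PrimeLevelFamEdge`, crux K_A `MomentsBeyondDiagonal` (stmt-Parity-20007), line «petersson_layers» v4, stub `stub_diag`:
# **the `M₆`-decorated shifted BLOCK is `O(log^{p+r₁+r₂+2}M)`** (the `M₆`-twin of `…DiagDecorM4Block`; decoration
# `D = 15P₂³ − 30P₂P₄ + 16P₆`, orders `i + j = 6` of `stub_diag`)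

`…DiagDecorShiftedBlockDecorSel.selbergBlockDecor_expand` with `Dk = D` and the crude piece bounds of `…DiagDecorM6Collapse`:

* `abs_selbergBlockM6_le` — `|Sel(τD(k₁)ℓ⁺(k₁)^{r₁}·τ(k₂)ℓ⁺(k₂)^{r₂}·B^p)| ≤ C·log^{p+r₁+r₂+2}M` (`0 ≤ λ ≤ 1`, `P₀ = P₁ = 0`, `M ≥ 3`).

Def-free; theorems only. Helper `--supports stmt-Parity-20007`; closes nothing; K_A, K_B and the Parity summit are NOT proved;
nothing about Landau–Siegel zeros.

## References
* E. Kowalski, P. Michel, J. VanderKam, J. reine angew. Math. 526 (2000), (23)–(28) pp. 13–15 and Prop. 5.1 p. 18.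
  [cite: KowalskiMichelVanderKam2000, (23)–(28) — derivation (diagonal weight in real Selberg coordinates, sixth divisor-log moment)]
-/

noncomputable section

open scoped Real ArithmeticFunction.Moebius
open Finset ArithmeticFunction Polynomial

namespace Summit.Parity.GeneralizedHardyLittlewood.Theorems.MomentsBeyondDiagonal.DiagKernel

open Literature.NumberTheory.LFunctions Literature.NumberTheory.LFunctions.KMV2000
open MollifierMainTerm (W)
open Literature.NumberTheory.Sieve (one_le_log_of_three_le)

/-- **The `M₆`-decorated shifted block is `O(log^{p+r₁+r₂+2}M)`** (see the module docstring).
[cite: KowalskiMichelVanderKam2000, (23)–(28) — derivation] -/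
theorem abs_selbergBlockM6_le (P : ℝ[X]) (hP0 : P.coeff 0 = 0) (hP1 : P.coeff 1 = 0) (p r₁ r₂ : ℕ)
    {lam : ℝ} (hlam0 : 0 ≤ lam) (hlam1 : lam ≤ 1) :
    ∃ C : ℝ, 0 < C ∧ ∀ M : ℝ, 3 ≤ M →
      |∑ c ∈ Icc 1 ⌊M⌋₊, ∑ g ∈ Icc 1 (⌊M⌋₊ / c), (μ g : ℝ) * c *
          ∑ k₁ ∈ Icc 1 (⌊M⌋₊ / (c * g)), ∑ k₂ ∈ Icc 1 (⌊M⌋₊ / (c * g)),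
            ((μ (c * g * k₁) : ℝ) * ((psi (c * g * k₁))⁻¹ *
                P.eval (Real.log (M / ((c * g * k₁ : ℕ) : ℝ)) / Real.log M))) / ((c * g * k₁ : ℕ) : ℝ) *
              (((μ (c * g * k₂) : ℝ) * ((psi (c * g * k₂))⁻¹ *
                P.eval (Real.log (M / ((c * g * k₂ : ℕ) : ℝ)) / Real.log M))) / ((c * g * k₂ : ℕ) : ℝ)) *
              (((k₁.divisors.card : ℝ) *
                  (15 * (∑ q ∈ k₁.primeFactors, Real.log q ^ 2) ^ 3 -
                    30 * ((∑ q ∈ k₁.primeFactors, Real.log q ^ 2) * ∑ q ∈ k₁.primeFactors, Real.log q ^ 4) +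
                    16 * ∑ q ∈ k₁.primeFactors, Real.log q ^ 6) *
                  Real.log (M / ((c * g : ℕ) : ℝ) / k₁) ^ r₁) *
                ((k₂.divisors.card : ℝ) * Real.log (M / ((c * g : ℕ) : ℝ) / k₂) ^ r₂) *
                (lam * Real.log M - Real.log g - Real.log (M / ((c * g : ℕ) : ℝ))) ^ p)| ≤
        C * Real.log M ^ (p + r₁ + r₂ + 2) := by
  -- one constant per `t`
  have hex : ∀ t : ℕ, ∃ C : ℝ, 0 < C ∧ (t ≤ p → ∀ M : ℝ, 3 ≤ M →
      |∑ c ∈ Icc 1 ⌊M⌋₊, ∑ g ∈ Icc 1 (⌊M⌋₊ / c), (μ g : ℝ) * c * Real.log g ^ t * (W (c * g) ^ 2 *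
          ((lam * Real.log M - Real.log (M / ((c * g : ℕ) : ℝ))) ^ (p - t) *
            (∑ c' ∈ Finset.range (P.natDegree + 1), P.coeff c' *
              ((∑ k ∈ Icc 1 ⌊M / ((c * g : ℕ) : ℝ)⌋₊, (if k.Coprime (c * g) then W k else 0) *
                ((k.divisors.card : ℝ) *
                  (15 * (∑ q ∈ k.primeFactors, Real.log q ^ 2) ^ 3 -
                    30 * ((∑ q ∈ k.primeFactors, Real.log q ^ 2) * ∑ q ∈ k.primeFactors, Real.log q ^ 4) +
                    16 * ∑ q ∈ k.primeFactors, Real.log q ^ 6)) *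
                Real.log (M / ((c * g : ℕ) : ℝ) / k) ^ (c' + r₁)) / Real.log M ^ c')) *
            (∑ c' ∈ Finset.range (P.natDegree + 1), P.coeff c' *
              ((∑ k ∈ Icc 1 ⌊M / ((c * g : ℕ) : ℝ)⌋₊, (if k.Coprime (c * g) then W k else 0) * (k.divisors.card : ℝ) *
                Real.log (M / ((c * g : ℕ) : ℝ) / k) ^ (c' + r₂)) / Real.log M ^ c'))))| ≤
        C * Real.log M ^ (p + r₁ + r₂ + 2)) := by
    intro t
    by_cases htp : t ≤ p
    · rcases Nat.eq_zero_or_pos t with ht0 | ht1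
      · subst ht0
        obtain ⟨C, hC, h⟩ := abs_collapseM6_zero_le P hP0 hP1 (p - 0) r₁ r₂ hlam0 hlam1
        refine ⟨C, hC, fun _ M hM ↦ ?_⟩
        have h' := h M hM
        rw [show p - 0 + r₁ + r₂ + 2 = p + r₁ + r₂ + 2 by omega] at h'
        exact h'
      · obtain ⟨C, hC, h⟩ := abs_collapseM6_logPow_le P hP0 hP1 (show 1 ≤ t from ht1) (p - t) r₁ r₂ hlam0 hlam1
        refine ⟨C, hC, fun _ M hM ↦ ?_⟩
        have h' := h M hM
        rw [show t + (p - t) + r₁ + r₂ + 2 = p + r₁ + r₂ + 2 by omega] at h'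
        exact h'
    · exact ⟨1, one_pos, fun h ↦ absurd h htp⟩
  choose Ct hCt0 hCt using hex
  set K : ℝ := ∑ t ∈ Finset.range (p + 1), (p.choose t : ℝ) * Ct t with hK
  have hK0 : 0 ≤ K := Finset.sum_nonneg fun t _ ↦ by have := hCt0 t; positivity
  refine ⟨K + 1, by positivity, fun M hM ↦ ?_⟩
  have hℓ1 : 1 ≤ Real.log M := one_le_log_of_three_le hM
  have hx := selbergBlockDecor_expand
    (fun k : ℕ ↦ 15 * (∑ q ∈ k.primeFactors, Real.log q ^ 2) ^ 3 -
                    30 * ((∑ q ∈ k.primeFactors, Real.log q ^ 2) * ∑ q ∈ k.primeFactors, Real.log q ^ 4) +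
                    16 * ∑ q ∈ k.primeFactors, Real.log q ^ 6)
    P M lam p r₁ r₂
  beta_reduce at hx
  rw [hx]
  have hterm : ∀ t ∈ Finset.range (p + 1), |(p.choose t : ℝ) * (-1) ^ t *
      ∑ c ∈ Icc 1 ⌊M⌋₊, ∑ g ∈ Icc 1 (⌊M⌋₊ / c), (μ g : ℝ) * c * Real.log g ^ t * (W (c * g) ^ 2 *
          ((lam * Real.log M - Real.log (M / ((c * g : ℕ) : ℝ))) ^ (p - t) *
            (∑ c' ∈ Finset.range (P.natDegree + 1), P.coeff c' *
              ((∑ k ∈ Icc 1 ⌊M / ((c * g : ℕ) : ℝ)⌋₊, (if k.Coprime (c * g) then W k else 0) *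
                ((k.divisors.card : ℝ) *
                  (15 * (∑ q ∈ k.primeFactors, Real.log q ^ 2) ^ 3 -
                    30 * ((∑ q ∈ k.primeFactors, Real.log q ^ 2) * ∑ q ∈ k.primeFactors, Real.log q ^ 4) +
                    16 * ∑ q ∈ k.primeFactors, Real.log q ^ 6)) *
                Real.log (M / ((c * g : ℕ) : ℝ) / k) ^ (c' + r₁)) / Real.log M ^ c')) *
            (∑ c' ∈ Finset.range (P.natDegree + 1), P.coeff c' *
              ((∑ k ∈ Icc 1 ⌊M / ((c * g : ℕ) : ℝ)⌋₊, (if k.Coprime (c * g) then W k else 0) * (k.divisors.card : ℝ) *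
                Real.log (M / ((c * g : ℕ) : ℝ) / k) ^ (c' + r₂)) / Real.log M ^ c'))))| ≤
        (p.choose t : ℝ) * Ct t * Real.log M ^ (p + r₁ + r₂ + 2) := by
    intro t ht
    have htp : t ≤ p := Nat.lt_succ_iff.1 (Finset.mem_range.1 ht)
    have h := hCt t htp M hM
    rw [abs_mul, abs_mul, abs_pow, abs_neg, abs_one, one_pow, mul_one,
      abs_of_nonneg (by positivity : (0 : ℝ) ≤ (p.choose t : ℝ)), mul_assoc]
    exact mul_le_mul_of_nonneg_left h (by positivity)
  calc _ ≤ ∑ t ∈ Finset.range (p + 1), (p.choose t : ℝ) * Ct t * Real.log M ^ (p + r₁ + r₂ + 2) :=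
        (Finset.abs_sum_le_sum_abs _ _).trans (Finset.sum_le_sum hterm)
    _ = K * Real.log M ^ (p + r₁ + r₂ + 2) := by rw [hK, Finset.sum_mul]
    _ ≤ (K + 1) * Real.log M ^ (p + r₁ + r₂ + 2) := by gcongr; linarith

end Summit.Parity.GeneralizedHardyLittlewood.Theorems.MomentsBeyondDiagonal.DiagKernel

end
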